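import Summits.ABC.IUTFork.Cor312RegimeVerbatimPrVolNeg
import HarnessLib

/-!
# [IUTchIII] Cor. 3.12 — the REGIME DICHOTOMY at the print-normalised sharp setting of record, EXPLICIT FORM for sharp
# pilot ideles supported at ONE bad place per prime: `A ≤ B ⟹ Statement`, `B + C₂ < A ⟹ ¬ Statement`, with
# `A = PN_j Σ_p β_p^{j+1}·j²·D_p·log p` (slot-symmetrised Θ-mass) and `B = Σ_p β_p·D_p·log p` (`q`-mass)

PROOF-ONLY support piece of the abc-iut cell (Cor. 3.12 cone, D-0067; seat abc-iut-w4-d107, gen 4; part 9, sequel of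
parts 7–8 `Cor312RegimeVerbatimPrVol(Neg)`). TAKES NO SIDE on [IUTchIII] Cor. 3.12; theorems only, 0 `def`s, no new
`Prop` fact. DATA: at abc-iut-c312-7's `Real.settingPrVolSharp` (Θ-boxes and `q`-centre READ OFF the pilot ideles; no
re-gluing), pilot ideles whose bad places lie over a finite set `U` of ODD primes UNRAMIFIED in `F`, and over each
`p ∈ U` ONE designated place `v_p` carrying the depth: `‖t_{q,v}‖ = ‖p^{D_p·[v = v_p]}‖`, `‖t_{Θ,i+1,v}‖ =
‖p^{(i+1)²·D_p·[v = v_p]}‖` (the SHARP reading `q^{j²}`, [IUTchIII] Rmk. 3.1.1; Dupuy–Hilado (3.4)), `β_p := Pr(v_p) =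
n_{v_p}/[F:ℚ]` the BAD MASS at `p` (Dupuy–Hilado §3.6). Then (parts 7–8 with abc-iut-c312-5's exact local hull value):
`Θside = −A`, `Qside = −B` with
  `A := PN_i Σ_{p∈U} β_p^{i+2}·(i+1)²·D_p·log p`   (only the packets `v⃗ = (v_p,…,v_p)`, of weight `β_p^{j+1}`, keep a
  non-unit slot-minimum: `sum_weightPr_mul_ite_forall_eq`, `inf'_ite_eq`),
  `B := Σ_{p∈U} β_p·D_p·log p`   (marginal of the last slot: `sum_weightPr_mul_ite_last_eq`), and
* **`settingPrVolSharp_regime_dichotomy_single`** — `∃ C₂ ≥ 0` from `(X, logv)` (before every context and idele binder):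
  `(A ≤ B ⟹ Statement) ∧ (B + C₂ < A ⟹ ¬ Statement)`. READING: since `A = Σ_p β_p·D_p·log p·PN_i((i+1)²·β_p^{i+1})`,
  the first half applies whenever `PN_i((i+1)²·β_p^{i+1}) ≤ 1` at every `p ∈ U` — the typed [IUTchIII] Cor. 3.12 HOLDS at
  genuine SPLIT data (`β*(ℓ⋇ = 2) ≈ 0.53`, e.g. `p` split into two places of equal degree, one of them bad, `ℓ = 5`), BY
  (Ind1)-INFLATION, not by the disputed inference; the second half is the bad-mass-one deep-`q` regime (`β_p = 1`,
  `A = κ·B`, `κ = (ℓ⋇+1)(2ℓ⋇+1)/6 ≥ 5/2`).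
HONEST SCOPE as in parts 7–8: (Ind2) as typed (`Real.ismDH`), sharp (Ind3) reading, trivial archimedean container, free
ideles (realising ones exist iff `2l ∣ ord_v(q_v)`, plan C-R16); the positive instances are inflation-dominated; nothing
here asserts or denies [IUTchIII] Cor. 3.12 for initial Θ-data. typed ≠ proved; instantiated ≠ endorsed.
[claim: Mochizuki2012, status: disputed] [cite: DupuyHilado2025, §3.4, §3.6, §4.7] [cite: ScholzeStix2018, §2.2 pp. 9–10]
-/

noncomputable section

open Set Function NumberField IsDedekindDomain
open scoped Pointwise

namespace Summit.ABC

namespace IUTFork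

namespace Thm311

namespace Real

open Cor312 Cor312.Setting Cor312Vol Literature.IUT.LogThetaLattice Literature.IUT.LogVolume

variable {F : Type} [Field F] [NumberField F] (X : PilotData F) {logv : PadicLogs F} (hlog : LogvAnalytic logv)

/-! ## §1. Three finite-sum identities on the `(j+1)`-packet over `p` -/

/-- The slot-minimum of an indicator profile: `min_a (c·[e(a) = x₀]) = c·[∀ a, e(a) = x₀]` for `c ≥ 0`. [folklore] -/
theorem inf'_ite_eq {ι α : Type*} [Fintype ι] [Nonempty ι] [DecidableEq α] (e : ι → α) (x₀ : α) {c : ℤ}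
    (hc : 0 ≤ c) :
    Finset.univ.inf' Finset.univ_nonempty (fun a => if e a = x₀ then c else 0) =
      if ∀ a, e a = x₀ then c else 0 := by
  classical
  by_cases hall : ∀ a, e a = x₀
  · rw [if_pos hall]
    refine le_antisymm ?_ (Finset.le_inf' _ _ fun a _ => by rw [if_pos (hall a)])
    obtain ⟨a⟩ := (inferInstance : Nonempty ι)
    exact (Finset.inf'_le _ (Finset.mem_univ a)).trans (by rw [if_pos (hall a)])
  · rw [if_neg hall]
    obtain ⟨a, ha⟩ := not_forall.mp hall
    refine le_antisymm ((Finset.inf'_le _ (Finset.mem_univ a)).trans (by rw [if_neg ha]))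
      (Finset.le_inf' _ _ fun b _ => ?_)
    split_ifs
    · exact hc
    · exact le_rfl

open scoped Classical in
/-- **Only the constant packet `(v_p, …, v_p)` survives an all-slots indicator, with weight `β_p^{j+1}`**:
`Σ_{v⃗} Pr(v⃗)·c·[∀ a, v⃗(a) = v_p] = Pr(v_p)^{j+1}·c`. [cite: DupuyHilado2025, §3.6] -/
theorem sum_weightPr_mul_ite_forall_eq (pp : Nat.Primes) (j : (thetaIndex X).Label)
    (x₀ : (thetaIndex X).Fibre (.inr pp)) (c : ℝ) :
    haveI : Fact (pp : ℕ).Prime := ⟨pp.2⟩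
    ∑ e : (presAt X hlog pp).toLocalPieces.E j,
        weightPr X pp.1 j e * (if ∀ a, e a = x₀ then c else 0) =
      weight F (placeOf X pp.1 x₀) ^ ((j : ℕ) + 1) * c := by
  haveI : Fact (pp : ℕ).Prime := ⟨pp.2⟩
  classical
  have h1 : (∑ e : (presAt X hlog pp).toLocalPieces.E j, weightPr X pp.1 j e * (if ∀ a, e a = x₀ then c else 0)) =
      weightPr X pp.1 j (fun _ => x₀) * (if ∀ a : (thetaIndex X).Caps j, (fun _ : (thetaIndex X).Caps j => x₀) a = x₀
        then c else 0) :=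
    Finset.sum_eq_single (fun _ => x₀)
      (fun e _ hne => by
        have hna : ¬ ∀ a, e a = x₀ := fun h => hne (funext h)
        simp only [hna, if_false, mul_zero])
      (fun h => absurd (Finset.mem_univ (α := (presAt X hlog pp).toLocalPieces.E j) _) h)
  refine h1.trans ?_
  simp only [forall_const, if_true]
  congr 1
  show (∏ a : (thetaIndex X).Caps j, weight F (placeOf X pp.1 x₀)) = _
  simp only [Finset.prod_const, Finset.card_univ, Fintype.card_fin]

open scoped Classical in
/-- **The marginal of the LAST slot**: `Σ_{v⃗} Pr(v⃗)·c·[v⃗(j) = v_p] = Pr(v_p)·c` (Dupuy–Hilado's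
`𝔼(f(v_j) : v⃗) = 𝔼(f(v) : v)`, abc-iut-c312-3 `tupleWeights_expect_coord`). [cite: DupuyHilado2025, Thm. 3.10.1 proof] -/
theorem sum_weightPr_mul_ite_last_eq (pp : Nat.Primes) (j : (thetaIndex X).Label)
    (x₀ : (thetaIndex X).Fibre (.inr pp)) (c : ℝ) :
    haveI : Fact (pp : ℕ).Prime := ⟨pp.2⟩
    ∑ e : (presAt X hlog pp).toLocalPieces.E j,
        weightPr X pp.1 j e * (if e (Fin.last _) = x₀ then c else 0) =
      weight F (placeOf X pp.1 x₀) * c := by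
  haveI : Fact (pp : ℕ).Prime := ⟨pp.2⟩
  classical
  set v₀ : placesOver F pp := fibreEquivPlacesOver X pp x₀ with hv₀
  have hinj : ∀ x : (thetaIndex X).Fibre (.inr pp), fibreEquivPlacesOver X pp x = v₀ ↔ x = x₀ := fun x =>
    ⟨fun h => (fibreEquivPlacesOver X pp).injective (h.trans hv₀.symm), fun h => by rw [h]⟩
  -- transfer to tuples of places over `p` and use the coordinate-expectation identity
  have step : ∑ e : (presAt X hlog pp).toLocalPieces.E j,
      weightPr X pp.1 j e * (if e (Fin.last _) = x₀ then c else 0) =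
      ∑ e' : Fin ((j : ℕ) + 1) → placesOver F pp,
        (if e' (Fin.last _) = v₀ then c else 0) * (tupleWeights F pp (j : ℕ)).pr e' := by
    refine Finset.sum_equiv (Equiv.arrowCongr (Equiv.refl ((thetaIndex X).Caps j)) (fibreEquivPlacesOver X pp))
      (fun _ => ⟨fun _ => Finset.mem_univ _, fun _ => Finset.mem_univ _⟩) (fun e _ => ?_)
    rw [mul_comm]
    exact congrArg₂ (· * ·) (if_congr (hinj (e (Fin.last _))).symm rfl rfl) rfl
  rw [step]
  have h2 := tupleWeights_expect_coord F pp (j : ℕ) (Fin.last _) (fun v : placesOver F pp => if v = v₀ then c else 0)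
  unfold ProbWeights.expect at h2
  rw [h2]
  refine (Fintype.sum_eq_single v₀ fun v hv => ?_).trans ?_
  · show (if v = v₀ then c else 0) * _ = 0
    simp only [hv, if_false, zero_mul]
  · show (if v₀ = v₀ then c else 0) * (localWeights F pp).pr v₀ = weight F (placeOf X pp.1 x₀) * c
    simp only [if_true, localWeights_pr, mul_comm c]
    rfl

/-! ## §2. The two masses and the explicit dichotomy -/

open scoped Classical in
/-- **THE REGIME DICHOTOMY, EXPLICIT SINGLE-BAD-PLACE FORM** (module docstring): `∃ C₂ ≥ 0` from `(X, logv)` such that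
for every context, every such pilot ideles and depths `D_p`, with `β_p := Pr(v_p)`,
`A := PN_i Σ_{p∈U} β_p^{i+2}·(i+1)²·D_p·log p`, `B := Σ_{p∈U} β_p·D_p·log p`:
`(A ≤ B ⟹ Statement) ∧ (B + C₂ < A ⟹ ¬ Statement)`. [claim: Mochizuki2012, status: disputed] -/
theorem settingPrVolSharp_regime_dichotomy_single :
    ∃ C₂ : ℝ, 0 ≤ C₂ ∧
      ∀ (M : Type) [Field M] [NumberField M]
        (archPk : ∀ (j : (thetaIndex X).Label) (vQ : (thetaIndex X).VQ), Set ((logShellsDH X logv).Packet j vQ))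
        (archSub : ∀ (j : (thetaIndex X).Label) (v : (thetaIndex X).V),
          Set ((logShellsDH X logv).Packet j ((thetaIndex X).over v)))
        (Ψ : ℤ → ∀ v : (thetaIndex X).V, v ∈ (thetaIndex X).Vbad → Set ((logShellsDH X logv).StarPacket v))
        (act : ℤ → ∀ v : (thetaIndex X).V, v ∈ (thetaIndex X).Vbad →
          (logShellsDH X logv).StarPacket v → Module.End ℚ ((logShellsDH X logv).StarPacket v))
        (Mmod : ℤ → ∀ j : (thetaIndex X).LabelStar, Set ((logShellsDH X logv).GlobalPacket j.1))
        (region : ℤ → ∀ j : (thetaIndex X).LabelStar, FinDivisor M → ∀ vQ : (thetaIndex X).VQ,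
          Set ((logShellsDH X logv).Packet j.1 vQ))
        (n : ℤ) (HT : Type) (LogLink : HT → HT → Type) (IsFull : ∀ {s t : HT}, LogLink s t → Prop)
        (lat : LGPGaussianLogThetaLattice LogLink IsFull)
        (Frd : Type) (IsoF : Frd → Frd → Type) (Ob : Frd → Type) (realify : Frd → Frd) (Strip : Type)
        (IsoS : Strip → Strip → Type) (Mv : ∀ v : (thetaIndex X).V, v ∈ (thetaIndex X).Vbad → Type)
        (_ : ∀ v h, Monoid (Mv v h))
        (sig : GlobalLGPFrobenioidSignature (thetaIndex X).lstar (thetaIndex X).V (· ∈ (thetaIndex X).Vbad)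
          Frd IsoF Ob realify Strip IsoS Mv)
        (split : SplittingMonoids Mv) (ObΔ : Type) (N : ∀ v : (thetaIndex X).V, v ∈ (thetaIndex X).Vbad → Type)
        (_ : ∀ v h, Monoid (N v h)) (qData : QPilotData ObΔ N)
        (tq : ∀ (pp : Nat.Primes) (x : (thetaIndex X).Fibre (.inr pp)),
          haveI : Fact (pp : ℕ).Prime := ⟨pp.2⟩; kOf X pp.1 x)
        (t : ∀ (pp : Nat.Primes) (_ : Fin X.lstar) (x : (thetaIndex X).Fibre (.inr pp)),
          haveI : Fact (pp : ℕ).Prime := ⟨pp.2⟩; kOf X pp.1 x)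
        (ht0 : ∀ pp i x, t pp i x ≠ 0)
        (ht1 : ∀ (pp : Nat.Primes) (i : Fin X.lstar) (x : (thetaIndex X).Fibre (.inr pp)),
          haveI : Fact (pp : ℕ).Prime := ⟨pp.2⟩; placeOf X pp.1 x ∉ X.S → ‖t pp i x‖ = 1)
        (htq0 : ∀ pp x, tq pp x ≠ 0)
        (htq1 : ∀ (pp : Nat.Primes) (x : (thetaIndex X).Fibre (.inr pp)),
          haveI : Fact (pp : ℕ).Prime := ⟨pp.2⟩; placeOf X pp.1 x ∉ X.S → ‖tq pp x‖ = 1)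
        (U : Finset Nat.Primes),
        (∀ (pp : Nat.Primes) (x : (thetaIndex X).Fibre (.inr pp)),
          haveI : Fact (pp : ℕ).Prime := ⟨pp.2⟩; placeOf X pp.1 x ∈ X.S → pp ∈ U) →
        (∀ pp ∈ U, 2 < (pp : ℕ)) → (∀ pp ∈ U, ¬ ((pp : ℕ) : ℤ) ∣ NumberField.discr F) →
        ∀ (x₀ : ∀ pp : Nat.Primes, (thetaIndex X).Fibre (.inr pp)) (D : Nat.Primes → ℕ),
        (∀ (pp : Nat.Primes), pp ∈ U → ∀ (i : Fin (thetaIndex X).lstar) (x : (thetaIndex X).Fibre (.inr pp)),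
          haveI : Fact (pp : ℕ).Prime := ⟨pp.2⟩
          ‖t pp i x‖ = ‖((pp : ℕ) : ℚ_[pp]) ^ (if x = x₀ pp then ((((i : ℕ) + 1) ^ 2 * D pp : ℕ) : ℤ) else 0)‖) →
        (∀ (pp : Nat.Primes), pp ∈ U → ∀ (x : (thetaIndex X).Fibre (.inr pp)),
          haveI : Fact (pp : ℕ).Prime := ⟨pp.2⟩
          ‖tq pp x‖ = ‖((pp : ℕ) : ℚ_[pp]) ^ (if x = x₀ pp then ((D pp : ℕ) : ℤ) else 0)‖) →
        (processionNormalized (fun i : Fin (thetaIndex X).lstar => ∑ pp ∈ U,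
            (haveI : Fact (pp : ℕ).Prime := ⟨pp.2⟩;
              weight F (placeOf X pp.1 (x₀ pp)) ^ ((i : ℕ) + 2) * ((((i : ℕ) + 1 : ℕ) : ℝ) ^ 2 * D pp * Real.log (pp : ℕ)))) ≤
            ∑ pp ∈ U, (haveI : Fact (pp : ℕ).Prime := ⟨pp.2⟩;
              weight F (placeOf X pp.1 (x₀ pp)) * (D pp * Real.log (pp : ℕ))) →
          (settingPrVolSharp X hlog M archPk archSub Ψ act Mmod region n lat sig split qData tq t htq0 htq1).Statement) ∧
        ((∑ pp ∈ U, (haveI : Fact (pp : ℕ).Prime := ⟨pp.2⟩;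
              weight F (placeOf X pp.1 (x₀ pp)) * (D pp * Real.log (pp : ℕ)))) + C₂ <
          processionNormalized (fun i : Fin (thetaIndex X).lstar => ∑ pp ∈ U,
            (haveI : Fact (pp : ℕ).Prime := ⟨pp.2⟩;
              weight F (placeOf X pp.1 (x₀ pp)) ^ ((i : ℕ) + 2) * ((((i : ℕ) + 1 : ℕ) : ℝ) ^ 2 * D pp * Real.log (pp : ℕ)))) →
          ¬ (settingPrVolSharp X hlog M archPk archSub Ψ act Mmod region n lat sig split qData tq t htq0 htq1).Statement) := by
  classical
  obtain ⟨C₂, hC₂, hC⟩ := settingPrVolSharp_regime_dichotomy X hlog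
  refine ⟨C₂, hC₂, ?_⟩
  intro M _ _ archPk archSub Ψ act Mmod region n HT LogLink IsFull lat Frd IsoF Ob realify Strip IsoS Mv _ sig split
    ObΔ N _ qData tq t ht0 ht1 htq0 htq1 U hU hU2 hUd x₀ D hm hmq
  -- instantiate parts 7–8 with the indicator exponents
  have key := hC M archPk archSub Ψ act Mmod region n HT LogLink IsFull lat Frd IsoF Ob realify Strip IsoS Mv
    inferInstance sig split ObΔ N inferInstance qData tq t ht0 ht1 htq0 htq1 U hU hU2 hUd
    (fun pp i x => if x = x₀ pp then ((((i : ℕ) + 1) ^ 2 * D pp : ℕ) : ℤ) else 0) hm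
    (fun pp x => if x = x₀ pp then ((D pp : ℕ) : ℤ) else 0) hmq
  -- the Θ-side: only the constant packet survives the slot-minimum
  have hΘ : ∀ i : Fin (thetaIndex X).lstar, ∀ pp ∈ U,
      (haveI : Fact (pp : ℕ).Prime := ⟨pp.2⟩;
        ∑ e : (presAt X hlog pp).toLocalPieces.E (Setting.labelSucc i),
          weightPr X pp.1 (Setting.labelSucc i) e *
            (-(Finset.univ.inf' Finset.univ_nonempty (fun a =>
              (if e a = x₀ pp then ((((i : ℕ) + 1) ^ 2 * D pp : ℕ) : ℤ) else 0)) * Real.log (pp : ℕ))) =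
      -(weight F (placeOf X pp.1 (x₀ pp)) ^ ((i : ℕ) + 2) * ((((i : ℕ) + 1 : ℕ) : ℝ) ^ 2 * D pp * Real.log (pp : ℕ)))) := by
    intro i pp _
    haveI : Fact (pp : ℕ).Prime := ⟨pp.2⟩
    haveI : Nonempty ((thetaIndex X).Caps (Setting.labelSucc i)) := ⟨0⟩
    have hinf : ∀ e : (presAt X hlog pp).toLocalPieces.E (Setting.labelSucc i),
        ((Finset.univ.inf' Finset.univ_nonempty (fun a =>
          (if e a = x₀ pp then ((((i : ℕ) + 1) ^ 2 * D pp : ℕ) : ℤ) else 0)) : ℤ) : ℝ) =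
        if ∀ a, e a = x₀ pp then (((((i : ℕ) + 1) ^ 2 * D pp : ℕ) : ℤ) : ℝ) else 0 := by
      intro e
      rw [inf'_ite_eq e (x₀ pp) (by positivity)]
      split_ifs <;> simp
    have hrew : ∀ e : (presAt X hlog pp).toLocalPieces.E (Setting.labelSucc i),
        weightPr X pp.1 (Setting.labelSucc i) e *
            (-(Finset.univ.inf' Finset.univ_nonempty (fun a =>
              (if e a = x₀ pp then ((((i : ℕ) + 1) ^ 2 * D pp : ℕ) : ℤ) else 0)) * Real.log (pp : ℕ))) =
        -(weightPr X pp.1 (Setting.labelSucc i) e *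
          (if ∀ a, e a = x₀ pp then (((((i : ℕ) + 1) ^ 2 * D pp : ℕ) : ℤ) : ℝ) * Real.log (pp : ℕ) else 0)) := by
      intro e
      rw [hinf e]
      split_ifs <;> ring
    show ∑ e : (presAt X hlog pp).toLocalPieces.E (Setting.labelSucc i), _ = _
    rw [Finset.sum_congr rfl fun e _ => hrew e, Finset.sum_neg_distrib,
      sum_weightPr_mul_ite_forall_eq X hlog pp (Setting.labelSucc i) (x₀ pp)]
    have hj : ((Setting.labelSucc i : (thetaIndex X).Label) : ℕ) + 1 = (i : ℕ) + 2 := by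
      rw [Setting.labelSucc, Fin.val_succ]
    rw [hj]
    push_cast
    ring
  -- the q-side: the marginal of the last slot
  have hq : ∀ i : Fin (thetaIndex X).lstar, ∀ pp ∈ U,
      (haveI : Fact (pp : ℕ).Prime := ⟨pp.2⟩;
        ∑ e : (presAt X hlog pp).toLocalPieces.E (Setting.labelSucc i),
          weightPr X pp.1 (Setting.labelSucc i) e *
            (-((if e (Fin.last _) = x₀ pp then ((D pp : ℕ) : ℤ) else 0) : ℤ) * Real.log (pp : ℕ)) =
      -(weight F (placeOf X pp.1 (x₀ pp)) * (D pp * Real.log (pp : ℕ)))) := by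
    intro i pp _
    haveI : Fact (pp : ℕ).Prime := ⟨pp.2⟩
    have hrew : ∀ e : (presAt X hlog pp).toLocalPieces.E (Setting.labelSucc i),
        weightPr X pp.1 (Setting.labelSucc i) e *
            (-((if e (Fin.last _) = x₀ pp then ((D pp : ℕ) : ℤ) else 0) : ℤ) * Real.log (pp : ℕ)) =
        -(weightPr X pp.1 (Setting.labelSucc i) e *
          (if e (Fin.last _) = x₀ pp then (D pp : ℝ) * Real.log (pp : ℕ) else 0)) := by
      intro e
      split_ifs <;> push_cast <;> ring
    show ∑ e : (presAt X hlog pp).toLocalPieces.E (Setting.labelSucc i), _ = _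
    rw [Finset.sum_congr rfl fun e _ => hrew e, Finset.sum_neg_distrib,
      sum_weightPr_mul_ite_last_eq X hlog pp (Setting.labelSucc i) (x₀ pp)]
  have hΘsum : ∀ i : Fin (thetaIndex X).lstar,
      ∑ pp ∈ U, (haveI : Fact (pp : ℕ).Prime := ⟨pp.2⟩;
        ∑ e : (presAt X hlog pp).toLocalPieces.E (Setting.labelSucc i),
          weightPr X pp.1 (Setting.labelSucc i) e *
            (-(Finset.univ.inf' Finset.univ_nonempty (fun a =>
              (if e a = x₀ pp then ((((i : ℕ) + 1) ^ 2 * D pp : ℕ) : ℤ) else 0)) * Real.log (pp : ℕ)))) =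
      -∑ pp ∈ U, (haveI : Fact (pp : ℕ).Prime := ⟨pp.2⟩;
        weight F (placeOf X pp.1 (x₀ pp)) ^ ((i : ℕ) + 2) * ((((i : ℕ) + 1 : ℕ) : ℝ) ^ 2 * D pp * Real.log (pp : ℕ))) := by
    intro i
    rw [← Finset.sum_neg_distrib]
    exact Finset.sum_congr rfl fun pp hpp => hΘ i pp hpp
  have hqsum : ∀ i : Fin (thetaIndex X).lstar,
      ∑ pp ∈ U, (haveI : Fact (pp : ℕ).Prime := ⟨pp.2⟩;
        ∑ e : (presAt X hlog pp).toLocalPieces.E (Setting.labelSucc i),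
          weightPr X pp.1 (Setting.labelSucc i) e *
            (-((if e (Fin.last _) = x₀ pp then ((D pp : ℕ) : ℤ) else 0) : ℤ) * Real.log (pp : ℕ))) =
      -∑ pp ∈ U, (haveI : Fact (pp : ℕ).Prime := ⟨pp.2⟩;
        weight F (placeOf X pp.1 (x₀ pp)) * (D pp * Real.log (pp : ℕ))) := by
    intro i
    rw [← Finset.sum_neg_distrib]
    exact Finset.sum_congr rfl fun pp hpp => hq i pp hpp
  have hl : 0 < (thetaIndex X).lstar := lt_of_lt_of_le (by norm_num) (thetaIndex X).two_le_lstar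
  have hPNneg : ∀ f : Fin (thetaIndex X).lstar → ℝ,
      processionNormalized (fun i => -f i) = -processionNormalized f := fun f => by
    unfold processionNormalized; rw [Finset.sum_neg_distrib, neg_div]
  have hΘPN : processionNormalized (fun i : Fin (thetaIndex X).lstar => ∑ pp ∈ U,
      (haveI : Fact (pp : ℕ).Prime := ⟨pp.2⟩;
        ∑ e : (presAt X hlog pp).toLocalPieces.E (Setting.labelSucc i),
          weightPr X pp.1 (Setting.labelSucc i) e *
            (-(Finset.univ.inf' Finset.univ_nonempty (fun a =>
              (if e a = x₀ pp then ((((i : ℕ) + 1) ^ 2 * D pp : ℕ) : ℤ) else 0)) * Real.log (pp : ℕ))))) =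
      -processionNormalized (fun i : Fin (thetaIndex X).lstar => ∑ pp ∈ U,
        (haveI : Fact (pp : ℕ).Prime := ⟨pp.2⟩;
          weight F (placeOf X pp.1 (x₀ pp)) ^ ((i : ℕ) + 2) * ((((i : ℕ) + 1 : ℕ) : ℝ) ^ 2 * D pp * Real.log (pp : ℕ)))) := by
    rw [← hPNneg]; congr 1; funext i; exact hΘsum i
  have hqPN : processionNormalized (fun i : Fin (thetaIndex X).lstar => ∑ pp ∈ U,
      (haveI : Fact (pp : ℕ).Prime := ⟨pp.2⟩;
        ∑ e : (presAt X hlog pp).toLocalPieces.E (Setting.labelSucc i),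
          weightPr X pp.1 (Setting.labelSucc i) e *
            (-((if e (Fin.last _) = x₀ pp then ((D pp : ℕ) : ℤ) else 0) : ℤ) * Real.log (pp : ℕ)))) =
      -∑ pp ∈ U, (haveI : Fact (pp : ℕ).Prime := ⟨pp.2⟩;
        weight F (placeOf X pp.1 (x₀ pp)) * (D pp * Real.log (pp : ℕ))) := by
    have hfun : (fun i : Fin (thetaIndex X).lstar => ∑ pp ∈ U,
        (haveI : Fact (pp : ℕ).Prime := ⟨pp.2⟩;
          ∑ e : (presAt X hlog pp).toLocalPieces.E (Setting.labelSucc i),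
            weightPr X pp.1 (Setting.labelSucc i) e *
              (-((if e (Fin.last _) = x₀ pp then ((D pp : ℕ) : ℤ) else 0) : ℤ) * Real.log (pp : ℕ)))) =
        fun _ => -∑ pp ∈ U, (haveI : Fact (pp : ℕ).Prime := ⟨pp.2⟩;
          weight F (placeOf X pp.1 (x₀ pp)) * (D pp * Real.log (pp : ℕ))) := funext hqsum
    rw [hfun, processionNormalized_const hl]
  beta_reduce at key
  rw [hΘPN, hqPN] at key
  refine ⟨fun hAB => key.1 (by linarith), fun hlt => key.2 (by linarith)⟩

end Real

end Thm311

end IUTFork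

end Summit.ABC

end
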